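import Literature.NumberTheory.DiophantineApproximation.PolylogShiftHermitePade
import Literature.NumberTheory.DiophantineApproximation.DilogHermitePadeSeries
import Mathlib.Topology.Algebra.InfiniteSum.NatInt
import Mathlib.Analysis.SumOverResidueClass
import HarnessLib

/-!
# The `m = 4` bridge: `Li_s(±1/N)`, `Li_s(±1/N²)` through the shifted series `Φ_{s,r}(1/N⁴)`

Topic `Literature/NumberTheory/DiophantineApproximation`. The reduction of the real polylogarithm
values at the four points `±1/N`, `±1/N²` (the duplication tower of height two) to ONE point
`y = 1/N⁴` and the four shifted polylogarithm-type series
`Φ_{s,r}(y) = ∑_{k ≥ 0} y^{k+1}/(4k + r)^s`, `r = 1, …, 4` (`ShiftPade.lerchShift 4 r s y`,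
vocabulary file `PolylogShiftHermitePade.lean`; `Li_s(x) = ∑_{k ≥ 1} x^k/k^s` is
`DilogPade.polylogSeries s x`), for every integer `N ≥ 2` and every `s`:

* `summable_lerchShift_terms` — the series `∑_k y^{k+1}/(mk + r)^s` converges absolutely for
  `0 ≤ y < 1`, `r ≥ 1` (comparison with the geometric series);
* `polylogSeries_eq_lerchShift_four` — `Li_s(1/N) = ∑_{r'=1}^{4} N^{4−r'} Φ_{s,r'}(1/N⁴)`;
* `polylogSeries_neg_eq_lerchShift_four` —
  `Li_s(−1/N) = ∑_{r'=1}^{4} (−1)^{r'} N^{4−r'} Φ_{s,r'}(1/N⁴)`;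
* `polylogSeries_sq_eq_lerchShift_four` —
  `Li_s(1/N²) = 2^s Φ_{s,4}(1/N⁴) + N² 2^s Φ_{s,2}(1/N⁴)`;
* `polylogSeries_negSq_eq_lerchShift_four` —
  `Li_s(−1/N²) = 2^s Φ_{s,4}(1/N⁴) − N² 2^s Φ_{s,2}(1/N⁴)`.

(In the Lean statements the residue `r' = r + 1` runs over `r ∈ Finset.range 4`, and the factor
`N^{4−r'}` is `(N : ℝ) ^ (3 - r)` with `r ≤ 3`, an honest difference.)

The computation: split `Li_s(x) = ∑_{n ≥ 0} x^{n+1}/(n+1)^s` (`x = ±1/N`, absolutely convergent)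
over the residue classes `n = r + 4k` of `n mod 4` (`Nat.sumByResidueClasses`); the term is
`x^{r+4k+1}/(4k + r + 1)^s = (±1)^{r+1} N^{3−r} · y^{k+1}/(4k + r + 1)^s` since
`N^{3−r} N^{−4k−4} = N^{−(r+4k+1)}`. For `x = ±1/N²` split by the parity of `n`
(`tsum_even_add_odd`): for `n = 2j` the term is
`± (1/N²)^{2j+1}/(2j+1)^s = ± N² 2^s y^{j+1}/(4j+2)^s`, for `n = 2j+1` it is
`(1/N²)^{2j+2}/(2j+2)^s = 2^s y^{j+1}/(4j+4)^s`.

References: S. David, N. Hirata-Kohno, M. Kawashima, *Can polylogarithms at algebraic points be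
linearly independent?*, Moscow J. Comb. Number Th. 9 (2020), Thm 2.1 (the identity
`Li_s(ζx) = ∑_r ζ^r x^{r−m} Φ_{s,r}(x^m)`, `ζ^m = 1`, here `m = 4`, `ζ = ±1`, and `m = 2` at the
point `1/N²`). Everything here is PROVED from Mathlib's `tsum` API and
`DilogHermitePadeSeries.lean`; no definitions, no named facts. The Hermite–Padé forms, their
bounds and the linear independence itself are NOT here (sibling `PolylogShiftHermitePade*` files).
-/

noncomputable section

open Finset

namespace Literature.NumberTheory.DiophantineApproximation

namespace ShiftPade

/-- Absolute convergence of the shifted polylogarithm-type series: for `0 ≤ y < 1`, `r ≥ 1` and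
all `m, s`, the series `∑_k y^{k+1}/(mk + r)^s` (whose sum is `lerchShift m r s y`) is summable —
its terms are nonnegative and at most `y^{k+1}` (the denominators are `≥ 1`), so it is dominated
by the geometric series. [folklore] -/
theorem summable_lerchShift_terms (m r s : ℕ) (hr : 1 ≤ r) {y : ℝ} (hy : 0 ≤ y) (hy1 : y < 1) :
    Summable fun k : ℕ => y ^ (k + 1) / ((m : ℝ) * k + r) ^ s := by
  refine Summable.of_nonneg_of_le (fun k => by positivity) (fun k => ?_)
    ((summable_geometric_of_lt_one hy hy1).mul_left y)
  rw [← pow_succ']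
  have h1 : (1 : ℝ) ≤ (m : ℝ) * k + r :=
    le_add_of_nonneg_of_le (by positivity) (by exact_mod_cast hr)
  exact div_le_self (pow_nonneg hy _) (one_le_pow₀ h1)

/-- A summable real series over `ℕ` is the sum of its four residue-class subseries mod `4`:
`∑_n f(n) = ∑_{r<4} ∑_k f(r + 4k)` (`Nat.sumByResidueClasses` with the sum over `ZMod 4 = Fin 4`
rewritten as a sum over `Finset.range 4`). [folklore] -/
private theorem fourBridge_tsum_eq_sum_range {f : ℕ → ℝ} (hf : Summable f) :
    ∑' n, f n = ∑ r ∈ range 4, ∑' k, f (r + 4 * k) := by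
  rw [Nat.sumByResidueClasses hf 4]
  exact Fin.sum_univ_eq_sum_range (fun r => ∑' k, f (r + 4 * k)) 4

/-- The powers of `1/N` along the residue class `r` mod `4` (`r ≤ 3`, `N ≥ 2`):
`(1/N)^{r+4k+1} = N^{3−r} (1/N⁴)^{k+1}`, since `4(k+1) = (3 − r) + (r + 4k + 1)`. [folklore] -/
private theorem fourBridge_pow {N : ℕ} (hN : 2 ≤ N) {r : ℕ} (hr : r < 4) (k : ℕ) :
    (1 / (N : ℝ)) ^ (r + 4 * k + 1) = (N : ℝ) ^ (3 - r) * (1 / (N : ℝ) ^ 4) ^ (k + 1) := by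
  have hN0 : (N : ℝ) ≠ 0 := by positivity
  have h : 4 * (k + 1) = (3 - r) + (r + 4 * k + 1) := by omega
  rw [one_div_pow, one_div_pow, ← pow_mul, h, pow_add _ (3 - r), mul_one_div, ← div_div,
    div_self (pow_ne_zero _ hN0)]

/-- Summability of the series `∑_k (1/N)^{k+1}/(k+1)^s` defining `Li_s(1/N)` for `N ≥ 2`
(`0 ≤ 1/N < 1`). [folklore] -/
private theorem fourBridge_summable (s : ℕ) {N : ℕ} (hN : 2 ≤ N) :
    Summable fun k : ℕ => (1 / (N : ℝ)) ^ (k + 1) / ((k : ℝ) + 1) ^ s := by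
  have h1 : (1 : ℝ) < N := by exact_mod_cast hN
  have hx1 : 1 / (N : ℝ) < 1 := by rw [div_lt_one (by positivity)]; exact h1
  exact DilogPade.summable_polylogSeries s (by positivity) hx1

/-- The residue class `r` mod `4` of `Li_s(1/N)` (`r ≤ 3`, `N ≥ 2`):
`∑_k (1/N)^{r+4k+1}/(r+4k+1)^s = N^{3−r} Φ_{s,r+1}(1/N⁴)`. [folklore] -/
private theorem fourBridge_tsum_class (s : ℕ) {N : ℕ} (hN : 2 ≤ N) {r : ℕ} (hr : r < 4) :
    ∑' k : ℕ, (1 / (N : ℝ)) ^ (r + 4 * k + 1) / (((r + 4 * k : ℕ) : ℝ) + 1) ^ s =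
      (N : ℝ) ^ (3 - r) * lerchShift 4 (r + 1) s (1 / (N : ℝ) ^ 4) := by
  rw [lerchShift, ← tsum_mul_left]
  refine tsum_congr fun k => ?_
  have hc : ((r + 4 * k : ℕ) : ℝ) + 1 = ((4 : ℕ) : ℝ) * k + ((r + 1 : ℕ) : ℝ) := by
    push_cast; ring
  rw [hc, fourBridge_pow hN hr k, mul_div_assoc]

/-- **The `m = 4` bridge at `1/N`** (David–Hirata-Kohno–Kawashima 2020, the identity
`Li_s(ζx) = ∑_r ζ^r x^{r−m} Φ_{s,r}(x^m)` behind Thm 2.1, for `m = 4`, `ζ = 1`, `x = 1/N`): for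
every integer `N ≥ 2` and every `s`,
`Li_s(1/N) = N³ Φ_{s,1}(1/N⁴) + N² Φ_{s,2}(1/N⁴) + N Φ_{s,3}(1/N⁴) + Φ_{s,4}(1/N⁴)`, i.e.
`polylogSeries s (1/N) = ∑_{r<4} N^{3−r} · lerchShift 4 (r+1) s (1/N⁴)` (split
`∑_n N^{−n−1}/(n+1)^s` over `n mod 4`). [cite: DavidHirataKohnoKawashima2020, Thm 2.1] -/
theorem polylogSeries_eq_lerchShift_four (s : ℕ) {N : ℕ} (hN : 2 ≤ N) :
    DilogPade.polylogSeries s (1 / (N : ℝ)) =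
      ∑ r ∈ Finset.range 4, (N : ℝ) ^ (3 - r) * lerchShift 4 (r + 1) s (1 / (N : ℝ) ^ 4) := by
  rw [DilogPade.polylogSeries, fourBridge_tsum_eq_sum_range (fourBridge_summable s hN)]
  exact Finset.sum_congr rfl fun r hr => fourBridge_tsum_class s hN (Finset.mem_range.mp hr)

/-- The sign of the powers of `−1/N` is constant along a residue class mod `4`:
`(−1/N)^{r+4k+1} = (−1)^{r+1} (1/N)^{r+4k+1}`. [folklore] -/
private theorem fourBridge_neg_pow (N r k : ℕ) :
    (-(1 / (N : ℝ))) ^ (r + 4 * k + 1) = (-1) ^ (r + 1) * (1 / (N : ℝ)) ^ (r + 4 * k + 1) := by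
  rw [neg_pow, show r + 4 * k + 1 = (r + 1) + 2 * (2 * k) by ring, pow_add (-1 : ℝ), pow_mul,
    neg_one_sq, one_pow, mul_one]

/-- Summability of the series `∑_k (−1/N)^{k+1}/(k+1)^s` defining `Li_s(−1/N)` for `N ≥ 2`: its
terms have the norms `(1/N)^{k+1}/(k+1)^s` of a summable series. [folklore] -/
private theorem fourBridge_neg_summable (s : ℕ) {N : ℕ} (hN : 2 ≤ N) :
    Summable fun k : ℕ => (-(1 / (N : ℝ))) ^ (k + 1) / ((k : ℝ) + 1) ^ s := by
  refine Summable.of_norm ((fourBridge_summable s hN).congr fun k => ?_)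
  rw [norm_div, norm_pow, norm_pow, norm_neg,
    Real.norm_of_nonneg (by positivity : (0 : ℝ) ≤ 1 / N),
    Real.norm_of_nonneg (by positivity : (0 : ℝ) ≤ (k : ℝ) + 1)]

/-- The residue class `r` mod `4` of `Li_s(−1/N)` (`r ≤ 3`, `N ≥ 2`):
`∑_k (−1/N)^{r+4k+1}/(r+4k+1)^s = (−1)^{r+1} N^{3−r} Φ_{s,r+1}(1/N⁴)`. [folklore] -/
private theorem fourBridge_neg_tsum_class (s : ℕ) {N : ℕ} (hN : 2 ≤ N) {r : ℕ} (hr : r < 4) :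
    ∑' k : ℕ, (-(1 / (N : ℝ))) ^ (r + 4 * k + 1) / (((r + 4 * k : ℕ) : ℝ) + 1) ^ s =
      (-1) ^ (r + 1) * (N : ℝ) ^ (3 - r) * lerchShift 4 (r + 1) s (1 / (N : ℝ) ^ 4) := by
  rw [mul_assoc, ← fourBridge_tsum_class s hN hr, ← tsum_mul_left]
  refine tsum_congr fun k => ?_
  rw [fourBridge_neg_pow, mul_div_assoc]

/-- **The `m = 4` bridge at `−1/N`** (David–Hirata-Kohno–Kawashima 2020, the identity
`Li_s(ζx) = ∑_r ζ^r x^{r−m} Φ_{s,r}(x^m)` behind Thm 2.1, for `m = 4`, `ζ = −1`, `x = 1/N`): for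
every integer `N ≥ 2` and every `s`,
`Li_s(−1/N) = −N³ Φ_{s,1}(1/N⁴) + N² Φ_{s,2}(1/N⁴) − N Φ_{s,3}(1/N⁴) + Φ_{s,4}(1/N⁴)`, i.e.
`polylogSeries s (−1/N) = ∑_{r<4} (−1)^{r+1} N^{3−r} · lerchShift 4 (r+1) s (1/N⁴)` (the sign
`(−1)^{n+1}` of the `n`-th term is constant on each class `n ≡ r (mod 4)`).
[cite: DavidHirataKohnoKawashima2020, Thm 2.1] -/
theorem polylogSeries_neg_eq_lerchShift_four (s : ℕ) {N : ℕ} (hN : 2 ≤ N) :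
    DilogPade.polylogSeries s (-(1 / (N : ℝ))) =
      ∑ r ∈ Finset.range 4,
        (-1) ^ (r + 1) * (N : ℝ) ^ (3 - r) * lerchShift 4 (r + 1) s (1 / (N : ℝ) ^ 4) := by
  rw [DilogPade.polylogSeries, fourBridge_tsum_eq_sum_range (fourBridge_neg_summable s hN)]
  exact Finset.sum_congr rfl fun r hr => fourBridge_neg_tsum_class s hN (Finset.mem_range.mp hr)

/-- The odd powers of `1/N²` (`N ≥ 2`): `(1/N²)^{2j+1} = N² (1/N⁴)^{j+1}`, since
`4(j+1) = 2 + 2(2j+1)`. [folklore] -/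
private theorem sqBridge_pow_even {N : ℕ} (hN : 2 ≤ N) (j : ℕ) :
    (1 / (N : ℝ) ^ 2) ^ (2 * j + 1) = (N : ℝ) ^ 2 * (1 / (N : ℝ) ^ 4) ^ (j + 1) := by
  have hN0 : (N : ℝ) ≠ 0 := by positivity
  rw [one_div_pow, one_div_pow, ← pow_mul, ← pow_mul,
    show 4 * (j + 1) = 2 + 2 * (2 * j + 1) by ring, pow_add _ 2, mul_one_div, ← div_div,
    div_self (pow_ne_zero _ hN0)]

/-- The even powers of `1/N²`: `(1/N²)^{2j+2} = (1/N⁴)^{j+1}`. [folklore] -/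
private theorem sqBridge_pow_odd (N j : ℕ) :
    (1 / (N : ℝ) ^ 2) ^ (2 * j + 1 + 1) = (1 / (N : ℝ) ^ 4) ^ (j + 1) := by
  rw [one_div_pow, one_div_pow, ← pow_mul, ← pow_mul,
    show 2 * (2 * j + 1 + 1) = 4 * (j + 1) by ring]

/-- The even-index terms of `Li_s(1/N²)` (`N ≥ 2`):
`(1/N²)^{2j+1}/(2j+1)^s = N² 2^s · (1/N⁴)^{j+1}/(4j+2)^s` (`(4j+2)^s = 2^s (2j+1)^s`). [folklore] -/
private theorem sqBridge_term_even (s : ℕ) {N : ℕ} (hN : 2 ≤ N) (j : ℕ) :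
    (1 / (N : ℝ) ^ 2) ^ (2 * j + 1) / (((2 * j : ℕ) : ℝ) + 1) ^ s =
      (N : ℝ) ^ 2 * 2 ^ s *
        ((1 / (N : ℝ) ^ 4) ^ (j + 1) / (((4 : ℕ) : ℝ) * j + ((2 : ℕ) : ℝ)) ^ s) := by
  have h2 : (2 : ℝ) ^ s ≠ 0 := pow_ne_zero s two_ne_zero
  have hc : ((4 : ℕ) : ℝ) * j + ((2 : ℕ) : ℝ) = 2 * (((2 * j : ℕ) : ℝ) + 1) := by
    push_cast; ring
  rw [hc, mul_pow, sqBridge_pow_even hN j, mul_assoc, mul_div_assoc' ((2 : ℝ) ^ s),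
    mul_div_mul_left _ _ h2, mul_div_assoc]

/-- The odd-index terms of `Li_s(1/N²)`:
`(1/N²)^{2j+2}/(2j+2)^s = 2^s · (1/N⁴)^{j+1}/(4j+4)^s` (`(4j+4)^s = 2^s (2j+2)^s`). [folklore] -/
private theorem sqBridge_term_odd (s N j : ℕ) :
    (1 / (N : ℝ) ^ 2) ^ (2 * j + 1 + 1) / (((2 * j + 1 : ℕ) : ℝ) + 1) ^ s =
      2 ^ s * ((1 / (N : ℝ) ^ 4) ^ (j + 1) / (((4 : ℕ) : ℝ) * j + ((4 : ℕ) : ℝ)) ^ s) := by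
  have h2 : (2 : ℝ) ^ s ≠ 0 := pow_ne_zero s two_ne_zero
  have hc : ((4 : ℕ) : ℝ) * j + ((4 : ℕ) : ℝ) = 2 * (((2 * j + 1 : ℕ) : ℝ) + 1) := by
    push_cast; ring
  rw [hc, mul_pow, sqBridge_pow_odd N j, mul_div_assoc' ((2 : ℝ) ^ s), mul_div_mul_left _ _ h2]

/-- Summability of the series `∑_k (1/N²)^{k+1}/(k+1)^s` defining `Li_s(1/N²)` for `N ≥ 2`
(`0 ≤ 1/N² < 1`). [folklore] -/
private theorem sqBridge_summable (s : ℕ) {N : ℕ} (hN : 2 ≤ N) :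
    Summable fun k : ℕ => (1 / (N : ℝ) ^ 2) ^ (k + 1) / ((k : ℝ) + 1) ^ s := by
  have h1 : (1 : ℝ) < (N : ℝ) ^ 2 := one_lt_pow₀ (by exact_mod_cast hN) two_ne_zero
  have hx1 : 1 / (N : ℝ) ^ 2 < 1 := by rw [div_lt_one (by positivity)]; exact h1
  exact DilogPade.summable_polylogSeries s (by positivity) hx1

/-- Summability of the even-index terms of `Li_s(1/N²)` (`N ≥ 2`): a subseries of an absolutely
convergent series. [folklore] -/
private theorem sqBridge_summable_even (s : ℕ) {N : ℕ} (hN : 2 ≤ N) :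
    Summable fun j : ℕ => (1 / (N : ℝ) ^ 2) ^ (2 * j + 1) / (((2 * j : ℕ) : ℝ) + 1) ^ s :=
  (sqBridge_summable s hN).comp_injective (i := fun j : ℕ => 2 * j)
    (mul_right_injective₀ two_ne_zero)

/-- Summability of the odd-index terms of `Li_s(1/N²)` (`N ≥ 2`): a subseries of an absolutely
convergent series. [folklore] -/
private theorem sqBridge_summable_odd (s : ℕ) {N : ℕ} (hN : 2 ≤ N) :
    Summable fun j : ℕ =>
      (1 / (N : ℝ) ^ 2) ^ (2 * j + 1 + 1) / (((2 * j + 1 : ℕ) : ℝ) + 1) ^ s :=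
  (sqBridge_summable s hN).comp_injective (i := fun j : ℕ => 2 * j + 1)
    ((add_left_injective 1).comp (mul_right_injective₀ two_ne_zero))

/-- The even-index part of `Li_s(1/N²)` is `N² 2^s Φ_{s,2}(1/N⁴)` (`N ≥ 2`). [folklore] -/
private theorem sqBridge_tsum_even (s : ℕ) {N : ℕ} (hN : 2 ≤ N) :
    ∑' j : ℕ, (1 / (N : ℝ) ^ 2) ^ (2 * j + 1) / (((2 * j : ℕ) : ℝ) + 1) ^ s =
      (N : ℝ) ^ 2 * 2 ^ s * lerchShift 4 2 s (1 / (N : ℝ) ^ 4) := by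
  rw [lerchShift, ← tsum_mul_left]
  exact tsum_congr fun j => sqBridge_term_even s hN j

/-- The odd-index part of `Li_s(1/N²)` is `2^s Φ_{s,4}(1/N⁴)`. [folklore] -/
private theorem sqBridge_tsum_odd (s N : ℕ) :
    ∑' j : ℕ, (1 / (N : ℝ) ^ 2) ^ (2 * j + 1 + 1) / (((2 * j + 1 : ℕ) : ℝ) + 1) ^ s =
      2 ^ s * lerchShift 4 4 s (1 / (N : ℝ) ^ 4) := by
  rw [lerchShift, ← tsum_mul_left]
  exact tsum_congr fun j => sqBridge_term_odd s N j

/-- **The `m = 4` bridge at `1/N²`** (David–Hirata-Kohno–Kawashima 2020, the parity identity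
`Li_s(x) = 2^{−s} Li_s(x²) + x^{−1} Θ_s(x²)` behind Thm 2.1 at the point `x = 1/N²`, written in the
`m = 4` shifted series: `Φ_{s,4}(y) = 4^{−s} Li_s(y)`, `Φ_{s,2}(y) = 2^{−s} Θ_s(y)`): for every
integer `N ≥ 2` and every `s`, `Li_s(1/N²) = 2^s Φ_{s,4}(1/N⁴) + N² 2^s Φ_{s,2}(1/N⁴)`, i.e.
`polylogSeries s (1/N²) = 2^s · lerchShift 4 4 s (1/N⁴) + N² 2^s · lerchShift 4 2 s (1/N⁴)`
(split `∑_n N^{−2n−2}/(n+1)^s` into even and odd `n`).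
[cite: DavidHirataKohnoKawashima2020, Thm 2.1] -/
theorem polylogSeries_sq_eq_lerchShift_four (s : ℕ) {N : ℕ} (hN : 2 ≤ N) :
    DilogPade.polylogSeries s (1 / (N : ℝ) ^ 2) =
      2 ^ s * lerchShift 4 4 s (1 / (N : ℝ) ^ 4) +
        (N : ℝ) ^ 2 * 2 ^ s * lerchShift 4 2 s (1 / (N : ℝ) ^ 4) := by
  rw [← sqBridge_tsum_odd s N, ← sqBridge_tsum_even s hN, add_comm, DilogPade.polylogSeries]
  exact (tsum_even_add_odd (f := fun k : ℕ => (1 / (N : ℝ) ^ 2) ^ (k + 1) / ((k : ℝ) + 1) ^ s)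
    (sqBridge_summable_even s hN) (sqBridge_summable_odd s hN)).symm

/-- **The `m = 4` bridge at `−1/N²`** (David–Hirata-Kohno–Kawashima 2020, the parity identity
`Li_s(−x) = 2^{−s} Li_s(x²) − x^{−1} Θ_s(x²)` behind Thm 2.1 at the point `x = 1/N²`, written in
the `m = 4` shifted series): for every integer `N ≥ 2` and every `s`,
`Li_s(−1/N²) = 2^s Φ_{s,4}(1/N⁴) − N² 2^s Φ_{s,2}(1/N⁴)`, i.e.
`polylogSeries s (−1/N²) = 2^s · lerchShift 4 4 s (1/N⁴) − N² 2^s · lerchShift 4 2 s (1/N⁴)`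
(the odd powers of `−1/N²` change sign, the even ones do not).
[cite: DavidHirataKohnoKawashima2020, Thm 2.1] -/
theorem polylogSeries_negSq_eq_lerchShift_four (s : ℕ) {N : ℕ} (hN : 2 ≤ N) :
    DilogPade.polylogSeries s (-(1 / (N : ℝ) ^ 2)) =
      2 ^ s * lerchShift 4 4 s (1 / (N : ℝ) ^ 4) -
        (N : ℝ) ^ 2 * 2 ^ s * lerchShift 4 2 s (1 / (N : ℝ) ^ 4) := by
  have heven : ∀ j : ℕ, (-(1 / (N : ℝ) ^ 2)) ^ (2 * j + 1) / (((2 * j : ℕ) : ℝ) + 1) ^ s =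
      -((1 / (N : ℝ) ^ 2) ^ (2 * j + 1) / (((2 * j : ℕ) : ℝ) + 1) ^ s) := fun j => by
    rw [Odd.neg_pow (odd_two_mul_add_one j), neg_div]
  have hodd : ∀ j : ℕ,
      (-(1 / (N : ℝ) ^ 2)) ^ (2 * j + 1 + 1) / (((2 * j + 1 : ℕ) : ℝ) + 1) ^ s =
        (1 / (N : ℝ) ^ 2) ^ (2 * j + 1 + 1) / (((2 * j + 1 : ℕ) : ℝ) + 1) ^ s := fun j => by
    rw [Even.neg_pow ⟨j + 1, by ring⟩]
  have he : Summable fun j : ℕ =>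
      (-(1 / (N : ℝ) ^ 2)) ^ (2 * j + 1) / (((2 * j : ℕ) : ℝ) + 1) ^ s :=
    (sqBridge_summable_even s hN).neg.congr fun j => (heven j).symm
  have ho : Summable fun j : ℕ =>
      (-(1 / (N : ℝ) ^ 2)) ^ (2 * j + 1 + 1) / (((2 * j + 1 : ℕ) : ℝ) + 1) ^ s :=
    (sqBridge_summable_odd s hN).congr fun j => (hodd j).symm
  rw [sub_eq_add_neg, ← sqBridge_tsum_odd s N, ← sqBridge_tsum_even s hN, ← tsum_neg,
    ← tsum_congr hodd, ← tsum_congr heven, add_comm, DilogPade.polylogSeries]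
  exact (tsum_even_add_odd
    (f := fun k : ℕ => (-(1 / (N : ℝ) ^ 2)) ^ (k + 1) / ((k : ℝ) + 1) ^ s) he ho).symm

end ShiftPade

end Literature.NumberTheory.DiophantineApproximation
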